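import Mathlib
import HarnessLib
import Literature.NumberTheory.Transcendental.DrinfeldAssociatorIsGroupLikeProofs
import Literature.NumberTheory.Transcendental.DrinfeldAssociatorPentagonProofs
import Literature.NumberTheory.Transcendental.MultipleZetaRepeatedFoursProofs
import Literature.NumberTheory.Transcendental.MultipleZetaNewtonProofs
import Summits.KontsevichZagierPeriods.KontsevichZagierPeriods.Theorems.FurushoPentagonKernelModuloPeriodConjectureShuffleTwosAlternating
import Summits.KontsevichZagierPeriods.KontsevichZagierPeriods.Theorems.FurushoPentagonKernelModuloPeriodConjecturePowerFormReplicate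
import Summits.KontsevichZagierPeriods.KontsevichZagierPeriods.Theorems.FurushoPentagonKernelModuloPeriodConjectureReplicateEvenLeaf
import Summits.KontsevichZagierPeriods.KontsevichZagierPeriods.Theorems.FurushoPentagonKernelModuloPeriodConjectureThreeOneLeaf

/-!
# `KernelModuloPeriodConjecture`, line `Sketch`: closed forms of the families `{3,1}ⁿ` and `{4}ⁿ`

Crux `FurushoPentagon.KernelModuloPeriodConjecture` (stmt-KontsevichZagierPeriods-15058), line
`Sketch` (lead c3). The landed stubs `stub_threeOneLeaf` and `stub_replicateEvenLeaf` give, for every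
`n`, ONE rational with `c_{({3,1}ⁿ)}(φ) = r c_{({2}^{2n})}(φ)`, resp. `c_{({4}ⁿ)}(φ) = r' c_{({2}^{2n})}(φ)`, at
every group-like solution `φ` of Drinfeld's pentagon over every commutative `ℚ`-algebra. Evaluation
at the real Drinfeld associator `Φ_KZ` (`c_{binaryWord s}(Φ_KZ) = (-1)^{|s|} ζ(s)`) with the tree's
real evaluations `ζ({3,1}ⁿ) = 2π⁴ⁿ/(4n+2)!`, `ζ({4}ⁿ) = 2^{2n+1}π⁴ⁿ/(4n+2)!` ([BBBL1998], tree
`multipleZeta_threeOne`, `multipleZeta_replicate_four`) and `ζ({2}^{2n}) = π⁴ⁿ/(4n+1)!` (Hoffman,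
`multipleZeta_replicate_two`) pins them down:

* `stub_threeOneClosedForm` : `c_{({3,1}ⁿ)}(φ) = (1/(2n+1)) · c_{({2}^{2n})}(φ)` — **Zagier's conjecture
  `ζ(3,1,…,3,1) = ζ(2,…,2)/(2n+1) = 2π⁴ⁿ/(4n+2)!` holds for every associator**;
* `stub_replicateFourClosedForm` : `c_{({4}ⁿ)}(φ) = ((-4)ⁿ/(2n+1)) · c_{({2}^{2n})}(φ)` — `ζ(4,…,4) = 4ⁿ
  ζ(2,…,2)/(2n+1)` for every associator (`n = 1`: `3 c_{(4)} = -4 c_{(2,2)}`).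

References: [BBBL1998] §6 Thm 1; [Hoffman1992] Cor. 2.3, Thm 2.2; [Furusho2011] Thm 1.2.
-/

noncomputable section

namespace Summit.KontsevichZagierPeriods.FurushoPentagon.KernelModuloPeriodConjecture

open Literature.NumberTheory.Transcendental
open Real

/-- `{2}ᵏ`, `{4}ⁿ` and `{3,1}ⁿ` coefficients at `Φ_KZ`, and the pinning argument: if
`c_s(φ) = r c_t(φ)` universally and at `Φ_KZ` both sides are known nonzero reals `x = r' y`, then
`r = r'`. Here: the real identity `x = ρ y` with `y ≠ 0` and `x = r y` forces `(r : ℝ) = ρ`. [folklore] -/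
theorem closedForm_pin {r : ℚ} {ρ x y : ℝ} (hy : y ≠ 0) (h1 : x = (r : ℝ) * y) (h2 : x = ρ * y) :
    (r : ℝ) = ρ :=
  mul_right_cancel₀ hy (h1.symm.trans h2)

/-- **Zagier's conjecture for associators, closed form**: for every `n` and every group-like solution
`φ` of Drinfeld's pentagon over a commutative `ℚ`-algebra,
`c_{binaryWord {3,1}ⁿ}(φ) = (1/(2n+1)) · c_{binaryWord {2}^{2n}}(φ)` (at `Φ_KZ`:
`ζ({3,1}ⁿ) = ζ({2}^{2n})/(2n+1) = 2π⁴ⁿ/(4n+2)!`). [cite: BBBL1998, §6 Theorem 1] -/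
theorem stub_threeOneClosedForm :
    ∀ n : ℕ, ∀ (R : Type) [CommRing R] [Algebra ℚ R] (φ : NCSeries Bool R), NCSeries.IsGroupLike φ → NCSeries.DrinfeldPentagon φ → φ (MZV.binaryWord (List.replicate n [3, 1]).flatten) = ((1 : ℚ) / (2 * n + 1)) • φ (MZV.binaryWord (List.replicate (2 * n) 2)) := by
  intro n
  obtain ⟨r, hr⟩ := stub_threeOneLeaf stub_shuffleTwosAlternating stub_powerFormReplicate n
  have hΦ := hr ℝ drinfeldAssociator drinfeldAssociator_isGroupLike_holds
    drinfeldAssociator_pentagon_holds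
  rw [drinfeldAssociator_binaryWord (isAdmissible_threeOne n),
    drinfeldAssociator_binaryWord (MZV.isAdmissible_replicate_two (2 * n)), List.length_replicate,
    multipleZeta_threeOne n, multipleZeta_replicate_two (2 * n), Rat.smul_def] at hΦ
  have hlen : ((List.replicate n [3, 1]).flatten).length = 2 * n := by
    simp [List.length_flatten]; ring
  rw [hlen] at hΦ
  have hpi : (π : ℝ) ^ (4 * n) ≠ 0 := pow_ne_zero _ Real.pi_ne_zero
  have hf1 : ((4 * n + 1).factorial : ℝ) ≠ 0 := by positivity
  have hf2 : ((4 * n + 2).factorial : ℝ) ≠ 0 := by positivity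
  have hfac : ((4 * n + 2).factorial : ℝ) = (4 * n + 2) * ((4 * n + 1).factorial : ℝ) := by
    rw [Nat.factorial_succ]; push_cast; ring
  have hy : (-1 : ℝ) ^ (2 * n) * (π ^ (2 * (2 * n)) / ((2 * (2 * n) + 1).factorial : ℝ)) ≠ 0 := by
    rw [show 2 * (2 * n) = 4 * n by ring]
    exact mul_ne_zero (pow_ne_zero _ (by norm_num)) (div_ne_zero hpi hf1)
  have h2 : (-1 : ℝ) ^ (2 * n) * (2 * π ^ (4 * n) / ((4 * n + 2).factorial : ℝ)) =
      ((((1 : ℚ) / (2 * n + 1) : ℚ)) : ℝ) *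
        ((-1 : ℝ) ^ (2 * n) * (π ^ (2 * (2 * n)) / ((2 * (2 * n) + 1).factorial : ℝ))) := by
    rw [show 2 * (2 * n) = 4 * n by ring, hfac]
    push_cast
    field_simp
    ring
  have hr' := closedForm_pin hy hΦ h2
  intro R _ _ φ hg h5
  rw [hr R φ hg h5, Rat.cast_injective hr']

/-- **`ζ(4,…,4)` for associators, closed form**: for every `n` and every group-like solution `φ` of
Drinfeld's pentagon over a commutative `ℚ`-algebra,
`c_{binaryWord {4}ⁿ}(φ) = ((-4)ⁿ/(2n+1)) · c_{binaryWord {2}^{2n}}(φ)` (at `Φ_KZ`: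
`ζ({4}ⁿ) = 4ⁿ ζ({2}^{2n})/(2n+1) = 2^{2n+1}π⁴ⁿ/(4n+2)!`). [cite: Hoffman1992, Theorem 2.2] -/
theorem stub_replicateFourClosedForm :
    ∀ n : ℕ, ∀ (R : Type) [CommRing R] [Algebra ℚ R] (φ : NCSeries Bool R), NCSeries.IsGroupLike φ → NCSeries.DrinfeldPentagon φ → φ (MZV.binaryWord (List.replicate n 4)) = ((-4 : ℚ) ^ n / (2 * n + 1)) • φ (MZV.binaryWord (List.replicate (2 * n) 2)) := by
  intro n
  rcases Nat.eq_zero_or_pos n with rfl | hn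
  · intro R _ _ φ hg h5
    simp [MZV.binaryWord]
  obtain ⟨r, hr⟩ := stub_replicateEvenLeaf stub_powerFormReplicate 2 n (by norm_num) hn
  have hr4 : ∀ (R : Type) [CommRing R] [Algebra ℚ R] (φ : NCSeries Bool R), NCSeries.IsGroupLike φ →
      NCSeries.DrinfeldPentagon φ →
        φ (MZV.binaryWord (List.replicate n 4)) = r • φ (MZV.binaryWord (List.replicate (2 * n) 2)) := by
    intro R _ _ φ hg h5
    simpa using hr R φ hg h5
  have hΦ := hr4 ℝ drinfeldAssociator drinfeldAssociator_isGroupLike_holds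
    drinfeldAssociator_pentagon_holds
  rw [drinfeldAssociator_binaryWord (MZV.isAdmissible_replicate (by norm_num) n),
    drinfeldAssociator_binaryWord (MZV.isAdmissible_replicate_two (2 * n)), List.length_replicate,
    List.length_replicate, multipleZeta_replicate_four n, multipleZeta_replicate_two (2 * n),
    Rat.smul_def] at hΦ
  have hpi : (π : ℝ) ^ (4 * n) ≠ 0 := pow_ne_zero _ Real.pi_ne_zero
  have hf1 : ((4 * n + 1).factorial : ℝ) ≠ 0 := by positivity
  have hf2 : ((4 * n + 2).factorial : ℝ) ≠ 0 := by positivity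
  have hfac : ((4 * n + 2).factorial : ℝ) = (4 * n + 2) * ((4 * n + 1).factorial : ℝ) := by
    rw [Nat.factorial_succ]; push_cast; ring
  have hy : (-1 : ℝ) ^ (2 * n) * (π ^ (2 * (2 * n)) / ((2 * (2 * n) + 1).factorial : ℝ)) ≠ 0 := by
    rw [show 2 * (2 * n) = 4 * n by ring]
    exact mul_ne_zero (pow_ne_zero _ (by norm_num)) (div_ne_zero hpi hf1)
  have hsq : ((-1 : ℝ) ^ n) ^ 2 = 1 := by rw [← pow_mul, mul_comm, pow_mul]; simp
  have h2 : (-1 : ℝ) ^ n * (2 ^ (2 * n + 1) * π ^ (4 * n) / ((4 * n + 2).factorial : ℝ)) =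
      ((((-4 : ℚ) ^ n / (2 * n + 1) : ℚ)) : ℝ) *
        ((-1 : ℝ) ^ (2 * n) * (π ^ (2 * (2 * n)) / ((2 * (2 * n) + 1).factorial : ℝ))) := by
    rw [show 2 * (2 * n) = 4 * n by ring, hfac, show (-4 : ℚ) ^ n = (-1) ^ n * 2 ^ (2 * n) by
      rw [pow_mul, ← mul_pow]; norm_num, show (-1 : ℝ) ^ (2 * n) = 1 by rw [pow_mul]; simp]
    push_cast
    field_simp
    ring
  have hr' := closedForm_pin hy hΦ h2
  intro R _ _ φ hg h5
  rw [hr4 R φ hg h5, Rat.cast_injective hr']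

end Summit.KontsevichZagierPeriods.FurushoPentagon.KernelModuloPeriodConjecture

end
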